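import Literature.AlgebraicGeometry.Resolution.MaximalContactConeCriterion
import Mathlib.RingTheory.MvPolynomial.Homogeneous
import HarnessLib

/-!
# Non-wild points have a Hasse–Schmidt maximal-contact element of order one (Kollár's Lemma 3.74 (3) with differential operators, at the origin)

Topic: `Literature/AlgebraicGeometry/Resolution`. Kollár 2007, Lemma 3.74 (3) — "(char. 0 only!)
If `ord_x I = m` then `D^{m-1}(I)` has order `1` at `x`" (the input of Thm. 3.80 (2), maximal
contact) — and Villamayor 2008 §4.1 (the order criterion through `Diff^{b−1}_k(I)`, every
characteristic). With Grothendieck's differential operators in place of iterated derivations the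
statement holds in EVERY characteristic at every NON-WILD point: if some `f ∈ I` of order `m` at
the origin of affine space has a degree-`m` initial form `ψ` with a non-zero linear Hasse–Schmidt
derivative `D^{(B)} ψ`, `|B| + 1 = m` (automatic when `p ∤ m`,
`exists_hasseDeriv_ne_zero_of_not_dvd`; false exactly for `ψ ∈ K[x_1^p, …, x_n^p]`,
`forall_hasseDeriv_eq_zero_iff_forall_dvd` — `MaximalContactConeCriterion.lean`), then
`u := D^{(B)} f ∈ Diff^{≤ m−1}((f))` has order EXACTLY one at the origin: `u ∈ 𝔪 ∖ 𝔪²`.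

* `hasseDeriv_mem_pow_idealOfVars_sub` — `D^{(B)}` lowers the `𝔪`-adic order by at most `|B|`
  (`IsDiffOpLE.apply_mem_pow_sub` for the differential operator `D^{(B)}` of order `≤ |B|`);
* `hasseDeriv_sub_homogeneousComponent_mem_sq` — for `f ∈ 𝔪^m` and `|B| + 1 = m`,
  `D^{(B)} f ≡ D^{(B)} ψ (mod 𝔪²)`, `ψ` the degree-`m` homogeneous component (initial form) of `f`;
* **`hasseDeriv_mem_and_notMem_sq_of_initialForm`** — if `D^{(B)} ψ ≠ 0` then
  `D^{(B)} f ∈ 𝔪 ∖ 𝔪²` and `D^{(B)} f ∈ Diff^{≤ m−1}((f))` (a maximal-contact element in the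
  Hasse–Schmidt sense); **`exists_hasseDeriv_order_one_of_not_dvd`** — for `p ∤ m` (domain of
  characteristic `p`) and `f ∈ 𝔪^m ∖ 𝔪^{m+1}` such an element always exists (Kollár 3.74 (3) for
  a characteristic prime to the order; Hauser 2003 §4 (9)).

## Sources

* J. Kollár, *Lectures on Resolution of Singularities* (2007), Lemma 3.74 (3), Def. 3.79. [Kollar2007]
* O. Villamayor U., Rev. Mat. Iberoam. 24 (2008), §4.1. [VillamayorU2008ReesDiff]
* H. Hauser, Bull. AMS 40 (2003), §4 problem (9). [Hauser2003]
-/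

noncomputable section

open MvPolynomial
open scoped BigOperators

namespace Literature.AlgebraicGeometry.Resolution

variable {σ : Type*} [DecidableEq σ] {K : Type*} [CommRing K]

/-- **`D^{(B)}` lowers the order at the origin by at most `|B|`**: `g ∈ 𝔪^k ⇒ D^{(B)} g ∈ 𝔪^{k − |B|}`,
`𝔪 = (x_i : i)` (`D^{(B)}` is a differential operator of order `≤ |B|`, `isDiffOpLE_hasseDeriv`).
[cite: VillamayorU2008ReesDiff, §4.1] -/
theorem hasseDeriv_mem_pow_idealOfVars_sub {g : MvPolynomial σ K} {k : ℕ}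
    (hg : g ∈ idealOfVars σ K ^ k) (B : σ →₀ ℕ) :
    hasseDeriv K B g ∈ idealOfVars σ K ^ (k - B.degree) :=
  (isDiffOpLE_hasseDeriv K B.degree B le_rfl).apply_mem_pow_sub (idealOfVars σ K) k hg

omit [DecidableEq σ] in
/-- A homogeneous polynomial of degree `n` lies in `𝔪^n`. [folklore] -/
private theorem isHomogeneous_mem_pow_idealOfVars_aux {ψ : MvPolynomial σ K} {n : ℕ}
    (hψ : ψ.IsHomogeneous n) : ψ ∈ idealOfVars σ K ^ n := by
  rw [mem_pow_idealOfVars_iff']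
  intro d hd
  exact hψ.coeff_eq_zero (by omega)

omit [DecidableEq σ] in
/-- For `f ∈ 𝔪^m`, the difference `f − ψ` with its degree-`m` component `ψ` lies in `𝔪^{m+1}`.
[folklore] -/
private theorem sub_homogeneousComponent_mem_pow_succ {f : MvPolynomial σ K} {m : ℕ}
    (hf : f ∈ idealOfVars σ K ^ m) : f - homogeneousComponent m f ∈ idealOfVars σ K ^ (m + 1) := by
  rw [mem_pow_idealOfVars_iff'] at hf ⊢
  intro d hd
  rw [coeff_sub, coeff_homogeneousComponent]
  by_cases hdm : d.degree = m
  · rw [if_pos hdm, sub_self]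
  · rw [if_neg hdm, sub_zero]
    exact hf d (by omega)

/-- **`D^{(B)} f ≡ D^{(B)} ψ (mod 𝔪²)`** for `f ∈ 𝔪^m`, `ψ` its degree-`m` component and
`|B| + 1 = m`: the higher-order part `f − ψ ∈ 𝔪^{m+1}` contributes to `𝔪²`.
[cite: VillamayorU2008ReesDiff, §4.1] -/
theorem hasseDeriv_sub_homogeneousComponent_mem_sq {f : MvPolynomial σ K} {m : ℕ}
    (hf : f ∈ idealOfVars σ K ^ m) {B : σ →₀ ℕ} (hB : B.degree + 1 = m) :
    hasseDeriv K B f - hasseDeriv K B (homogeneousComponent m f) ∈ idealOfVars σ K ^ 2 := by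
  rw [← map_sub]
  have h := hasseDeriv_mem_pow_idealOfVars_sub (sub_homogeneousComponent_mem_pow_succ hf) B
  rwa [show m + 1 - B.degree = 2 by omega] at h

omit [DecidableEq σ] in
/-- A non-zero LINEAR form lies in `𝔪 ∖ 𝔪²`. [folklore] -/
private theorem mem_and_notMem_sq_of_isHomogeneous_one {ℓ : MvPolynomial σ K}
    (hℓ : ℓ.IsHomogeneous 1) (hℓ0 : ℓ ≠ 0) :
    ℓ ∈ idealOfVars σ K ∧ ℓ ∉ idealOfVars σ K ^ 2 := by
  refine ⟨by simpa using isHomogeneous_mem_pow_idealOfVars_aux hℓ, fun h2 => hℓ0 ?_⟩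
  rw [mem_pow_idealOfVars_iff'] at h2
  ext d
  rw [coeff_zero]
  by_cases hd : d.degree = 1
  · exact h2 d (by omega)
  · exact hℓ.coeff_eq_zero hd

/-- **A Hasse–Schmidt maximal-contact element at a non-wild point** (Kollár's Lemma 3.74 (3) with
differential operators, every characteristic): let `f ∈ 𝔪^m` (order `≥ m` at the origin of
`𝔸^σ_K`), `ψ` its degree-`m` initial form, and `B` with `|B| + 1 = m` and `D^{(B)} ψ ≠ 0`. Then
`u := D^{(B)} f` lies in `Diff^{≤ m−1}((f))`, in `𝔪`, and NOT in `𝔪²` — `u = 0` is a regular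
hypersurface germ through the origin cut out by a differential operator of order `≤ m − 1` applied
to `f`. [cite: Kollar2007, Lemma 3.74 (3), Def. 3.79] [cite: VillamayorU2008ReesDiff, §4.1] -/
theorem hasseDeriv_mem_and_notMem_sq_of_initialForm {f : MvPolynomial σ K} {m : ℕ}
    (hf : f ∈ idealOfVars σ K ^ m) {B : σ →₀ ℕ} (hB : B.degree + 1 = m)
    (hne : hasseDeriv K B (homogeneousComponent m f) ≠ 0) :
    hasseDeriv K B f ∈ diffIdeal K (m - 1) (Ideal.span {f}) ∧
      hasseDeriv K B f ∈ idealOfVars σ K ∧ hasseDeriv K B f ∉ idealOfVars σ K ^ 2 := by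
  have hlin : (hasseDeriv K B (homogeneousComponent m f)).IsHomogeneous 1 :=
    isHomogeneous_one_hasseDeriv (homogeneousComponent_isHomogeneous m f) hB
  obtain ⟨h1, h2⟩ := mem_and_notMem_sq_of_isHomogeneous_one hlin hne
  have hdiff := hasseDeriv_sub_homogeneousComponent_mem_sq hf hB
  refine ⟨hasseDeriv_mem_diffIdeal_span_singleton f hB, ?_, fun hsq => h2 ?_⟩
  · have := Ideal.add_mem _ (Ideal.pow_le_self two_ne_zero hdiff) h1
    rwa [sub_add_cancel] at this
  · have := Ideal.sub_mem _ hsq hdiff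
    rwa [sub_sub_cancel] at this

/-- **Kollár's Lemma 3.74 (3) for a characteristic prime to the order** (Hauser 2003 §4 (9)): over a
domain `K` of characteristic `p` with `p ∤ m`, if `f ∈ 𝔪^m ∖ 𝔪^{m+1}` (order exactly `m` at the
origin) then some Hasse–Schmidt derivative `D^{(B)} f`, `|B| + 1 = m`, is an element of
`Diff^{≤ m−1}((f))` of order exactly one at the origin (the degree-`m` initial form of `f` is
non-zero, hence not wild, `exists_hasseDeriv_ne_zero_of_not_dvd`).
[cite: Kollar2007, Lemma 3.74 (3)] [cite: Hauser2003, §4 problem (9)] -/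
theorem exists_hasseDeriv_order_one_of_not_dvd (p : ℕ) [CharP K p] [IsDomain K]
    {f : MvPolynomial σ K} {m : ℕ} (hf : f ∈ idealOfVars σ K ^ m)
    (hf' : f ∉ idealOfVars σ K ^ (m + 1)) (hpm : ¬ p ∣ m) :
    ∃ B : σ →₀ ℕ, B.degree + 1 = m ∧
      hasseDeriv K B f ∈ diffIdeal K (m - 1) (Ideal.span {f}) ∧
        hasseDeriv K B f ∈ idealOfVars σ K ∧ hasseDeriv K B f ∉ idealOfVars σ K ^ 2 := by
  have hψ0 : homogeneousComponent m f ≠ 0 := by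
    intro h0
    apply hf'
    have := sub_homogeneousComponent_mem_pow_succ hf
    rwa [h0, sub_zero] at this
  obtain ⟨B, hB, hne⟩ := exists_hasseDeriv_ne_zero_of_not_dvd p
    (homogeneousComponent_isHomogeneous m f) hψ0 hpm
  exact ⟨B, hB, hasseDeriv_mem_and_notMem_sq_of_initialForm hf hB hne⟩

end Literature.AlgebraicGeometry.Resolution

end
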